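import Literature.NumberTheory.LFunctions.FordProgram1Run25A
import Literature.NumberTheory.LFunctions.FordProgram1Run25B
import Literature.NumberTheory.LFunctions.FordProgram1Run25C
import HarnessLib

/-!
# Ford's "Program 1": kernel run 25 (`904 ≤ k ≤ 921`)

Topic `Literature/NumberTheory/LFunctions`. Everything here is PROVED (standard axioms):
`FordP1.checkT k = true` for `904 ≤ k ≤ 921`, i.e. the certified re-run of PROGRAM 1 of
K. Ford, Proc. LMS 85 (2002) (the second part of Theorem 3) for these `k` — see `FordProgram1.lean`
for the checker, its soundness `FordP1.row_of_checkK`, and the meaning of the constants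
(`ρ = FordP1.rhoOf k / 10⁵`, `θ = FordP1.thetaOf k / 10⁴`, `ω = FordP1.omOf k / 10⁴`).

This file no longer performs a kernel evaluation of its own: the single `decide +kernel` over all
eighteen `k` at once exceeded the full-build resource limits, so the range was re-run one `k` per
declaration in `FordProgram1Run25A.lean` (`904 ≤ k ≤ 910`), `FordProgram1Run25B.lean`
(`911 ≤ k ≤ 916`) and `FordProgram1Run25C.lean` (`917 ≤ k ≤ 921`); `FordP1.run25` below is the
original range statement, now assembled from `FordP1.run25A`, `FordP1.run25B`, `FordP1.run25C`.
The assembly of all runs is `FordTheorem3SmallK.lean` (which imports the three split files directly).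

## References

* K. Ford, Proc. London Math. Soc. (3) 85 (2002), 565–633; arXiv:1910.08209: Theorem 3, (1.7),
  Lemmas 3.4–3.5, Appendix "PROGRAM 1". [Ford2002]
-/

namespace Literature.NumberTheory.LFunctions
namespace FordP1

/-- **Kernel run 25**: `checkT k` for `904 ≤ k ≤ 921` (assembled from the per-`k` kernel runs
`run25A`, `run25B`, `run25C`). [cite: Ford2002, Theorem 3 (second part) and PROGRAM 1] -/
theorem run25 : ((List.range' 904 18).all checkT) = true := by
  rw [List.all_eq_true]
  intro k hk
  rw [List.mem_range'_1] at hk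
  by_cases h : k ≤ 910
  · exact run25A k hk.1 h
  by_cases h' : k ≤ 916
  · exact run25B k (by omega) h'
  · exact run25C k (by omega) (by omega)

end FordP1
end Literature.NumberTheory.LFunctions
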